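import Literature.Geometry.DiscreteGeometry.UnitDiscContactNumber
import Literature.Geometry.DiscreteGeometry.UnitDiscBondAngles
import Literature.Geometry.DiscreteGeometry.HarborthConstruction
import Literature.Geometry.DiscreteGeometry.HarborthContactNumberProof
import Literature.Geometry.DiscreteGeometry.HeitmannRadinStructure
import Literature.MathematicalPhysics.StatisticalMechanics.Theil2006EnergyBounds
import Literature.MathematicalPhysics.StatisticalMechanics.StickyChain
import Literature.MathematicalPhysics.StatisticalMechanics.LatticeMaximalFluctuations
import Literature.MathematicalPhysics.StatisticalMechanics.CrystallineSurfaceDensity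
import Literature.Analysis.Convexity.AnisotropicPerimeter
import Mathlib.LinearAlgebra.Determinant
import Mathlib.Logic.Relation
import Mathlib.Analysis.Complex.Isometry
import Mathlib.Analysis.Complex.OperatorNorm
import Mathlib.Analysis.Normed.Module.FiniteDimension
import HarnessLib

/-!
# Au Yeung–Friesecke–Schmidt 2012: crystallization in the Wulff shape for short-range pair
# potentials in two dimensions (sticky disc)

Topic `Literature/MathematicalPhysics/StatisticalMechanics`; cross-ladder literature-typing layer
(D-0088 (4)), cell `crystal3d-full`, seat `littype-FC1-2` (gen 5).  The two-dimensional ORIGIN of the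
Wulff-crystal-emergence programme whose fcc/hcp version (Cicalese–Kreutz–Leonardi 2023) is typed in
`WulffCrystalEmergence.lean` / `WulffCrystalGammaLimit.lean`, and the first-listed source of the target
`SurfaceLiminf` and of the crux `LiminfAssembly` of the venture route `StickyWulffConstant`
(`Summits/Ventures/Crystal3D`); until now the tree carried only citations of it
(`UnitDiscContactNumber.lean`: "Wulff shapes (Au Yeung–Friesecke–Schmidt 2012, Schmidt 2013): other
files").

## Source, as printed

Y. Au Yeung, G. Friesecke, B. Schmidt, *Minimizing atomic configurations of short range pair potentials
in two dimensions: crystallization in the Wulff shape*, Calc. Var. PDE **44** (2012) 81–100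
[AuYeungFrieseckeSchmidt2012] — read on the held arXiv text `paper:arxiv-0909.0927` (= arXiv:0909.0927v2,
the accepted version; theorem numbers as there; `pNNNN` = chunk of the held text).

* §1 (p0003), (1.1): `E(x₁,…,x_N) = Σ_{i ≠ j} V(|xᵢ − xⱼ|)`; **Definition 1.1**: "We say that an energy
  `E : (ℝ²)^N → ℝ` has crystallized ground states if its infimum is attained and any minimizer – after
  translation and rotation – is a subset of the triangular lattice `𝓛 := {m e₁ + n e₂ : m, n ∈ ℤ}`,
  `e₁ = (1, 0)`, `e₂ = (½, √3/2)`"; (1.3) the Heitmann–Radin sticky disc potential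
  `V(r) = +∞ (0 ≤ r < 1), −1 (r = 1), 0 (r > 1)`; (1.4) `μ_N = N⁻¹ Σᵢ δ_{xᵢ/√N}`.
* §2 (p0005): "(H1) (minimum at `r = 1`) `V(1) = −1`, `V(r) > −1` for all `r ≠ 1`; (H2) there exist
  constants `α ∈ (0,1]`, `β ∈ [1,∞)` such that `V(r) = +∞` for `r < α`, `V(r) = 0` for `r > β`, `V`
  continuous on `(α, β)`; (H3) (narrow potential well) the constants `α, β` from (H2) satisfy the
  condition that the ball of radius `β` contains at most six points whose distance from the center and
  mutual distance is `≥ α`."  (2.4): `inf E ≥ −6N`; (2.5): `inf E ≤ −6N + a N^{1/2} + b`, `a = 4√3`,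
  `b = 12`.
* §3 (p0006), **Definition 3.1**: "A finite set `S ⊂ ℝ²` … is called connected if for any two
  `x, y ∈ S` there exist `x₀,…,x_N ∈ S` such that `x₀ = x`, `x_N = y`, and … `|xⱼ − xⱼ₋₁| ≤ β` for all
  `j`."  Weak* convergence in `𝓜(ℝ²)` (dual of `C₀(ℝ²)`): `∫ f dμ_N → ∫ f dμ` for all `f ∈ C₀(ℝ²)`.
  `E_loc(x) := Σ_{y ∈ S∖{x}} V(|x − y|)`, "so that `E(S) = Σ_{x∈S} E_loc(x)`".
* **Theorem 1.1** (p0003; Formation of clusters with constant density and finite perimeter). "Suppose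
  … the interatomic potential satisfies (H1), (H2), (H3). Let `{x₁^{(N)},…,x_N^{(N)}}` be any sequence
  of connected `N`-particle configurations satisfying `E ≤ −6N + C N^{1/2}` for some constant `C`
  independent of `N`. Let `{μ_N}` be the associated sequence of re-scaled empirical measures
  `μ_N = N⁻¹ Σᵢ δ_{xᵢ^{(N)}/√N}`. Then: (i) Up to translation (… replacing `μ_N` by `μ_N(· + a_N)`) and
  passage to a subsequence, `μ_N` converges weak* in `𝓜(ℝ²)` to `μ ∈ 𝓜(ℝ²)`. (ii) The limit measure is
  of the form `μ = ρ χ_E`, where `ρ = 2/√3` … and `E` is a set of finite perimeter of volume `1/ρ`."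
* **Theorem 1.2** (p0004). "Suppose … (H1), (H2), (H3). Assume in addition that `E` has crystallized
  ground states (as is rigorously known e.g. when `V` is given by (1.3)). Let `{x₁^{(N)},…,x_N^{(N)}}` be
  any minimizing `N`-particle configuration of `E`, and let `μ_N` be the associated re-scaled empirical
  measure. As `N → ∞`, up to translation and rotation (… replacing `μ_N` by `μ_N(R_N · + a_N)` for some
  rotation `R_N ∈ SO(2)` and some `a_N ∈ ℝ²`) `μ_N` converges weak star to `μ = (2/√3) χ_h̄` where `h̄`
  is the regular hexagon `conv{±e₁, ±e₂, ±(e₂ − e₁)}`."  [PRINT NOTE below.]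
* **Theorem 5.1** (p0010). "The sequence of functionals `N^{−1/2}(I_N + 6N)` Gamma-converges, with
  respect to weak* convergence of probability measures, to the limit functional
  `I_∞(μ) := ∫_{∂*E} Γ(ν_E) dH¹` if `μ = (2/√3) χ_E` for a set `E` of finite perimeter of volume
  `√3/2`, `+∞` otherwise, where `Γ(ν) = 2(ν₂ − ν₁/√3)` for `ν = (−sin φ, cos φ)`, `φ ∈ [0, π/3]`,
  extended `2π/6`-periodically"; `I_N(μ) := ∫∫_{ℝ⁴∖diag} N V(N^{1/2}|x − y|) dμ⊗dμ` if
  `μ = N⁻¹ Σ δ_{xᵢ/√N}` for some `xᵢ ∈ 𝓛`, `+∞` otherwise ("`I_N(μ_N) = E(x₁,…,x_N)`"); §5 works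
  with the Heitmann–Radin potential and `S_N ⊂ 𝓛` ("we may without loss of generality assume …").
  P0010: "`I_N(μ_N) + 6N = 2√N 𝓗¹(∂H_N')`"; p0012: "the Wulff set is … a regular hexagon with bottom
  face parallel to the `e₁`-axis".

## PRINT NOTE (limit hexagon of Theorem 1.2)

The printed `h̄ = conv{±e₁, ±e₂, ±(e₂ − e₁)}` has circumradius `1` and area `3√3/2`, so that
`(2/√3)χ_h̄` has mass `3`, not `1`; by Theorem 1.1 (ii) (mass conservation, `|E| = 1/ρ = √3/2`) the
limit hexagon is its dilate by `1/√3` — exactly how the result is restated by the second author's sequel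
[Schmidt2013, (4)]: "`h` with corners `±(1/√3)(1,0)`, `±(1/(2√3))(1,√3)`, `±(1/(2√3))(−1,√3)`".
Typed with this normalisation (`wulffHexagon = (√3)⁻¹ • conv{±e₁, ±e₂, ±(e₂ − e₁)}`).

## Rendering

* Plane `ℝ² = Theil2006.Plane`; `𝓛 = Theil2006.triangularLattice` (`e₁ = triVec₁`, `e₂ = triVec₂`,
  literally the printed generators); configurations are labelled, `x : Fin N → ℝ²`, as in
  `UnitDiscContactNumber.lean` (Harborth / Heitmann–Radin).
* Potentials are real-valued `V : ℝ → ℝ`; the printed hard core "`V(r) = +∞` for `r < α`" is the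
  finite-energy CONSTRAINT `IsAdmissible α x` (all mutual distances `≥ α`): every statement of the
  source concerns configurations of finite energy (energy bounds, minimizers), for which the two
  readings agree; the values of `V` on `[0, α)` are never used.  The Heitmann–Radin potential (1.3) is
  the tree's `stickyPotential` (`StickyChain.lean`; `= −1 / 0` at `r = 1 / r > 1`) with `α = β = 1`
  (`isShortRangePotential_stickyPotential`, PROVED), and its energy on admissible configurations is
  `−2 · contactPairCount` (`energy_stickyPotential`, PROVED), so that its ground states are exactly the
  maximal disc configurations of `UnitDiscContactNumber.lean` (`isGroundState_stickyPotential_iff`).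
* "(H3) the ball of radius `β`" is the CLOSED ball (the source deduces the strict inequality
  `β < α/(2 sin(π/7))` from it, p0007, which needs the closed ball).
* `μ_N(· + a_N)` / `μ_N(R_N · + a_N)`: translating (rigidly moving) the measure is translating (rigidly
  moving) the configuration (`{R⁻¹(y/√N − a)} = {(R⁻¹y − √N R⁻¹a)/√N}`), so the motions act on
  configurations; "rotation `R_N ∈ SO(2)`" = linear isometry of determinant `1`.
* Weak* convergence in `𝓜(ℝ²) = C₀(ℝ²)*`: against continuous `g` with `g → 0` along `cocompact ℝ²`
  (`WeakStarTo`), as printed (p0006).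
* `∫_{∂*E} Γ(ν_E) dH¹` is rendered, as in `WulffCrystalGammaLimit.lean` / `FiniteRangeLatticeGammaLimit.lean`,
  by the distributional anisotropic perimeter `anisotropicPerimeter (wulffBody Γ) E` with constraint body
  the Wulff set `W_Γ = {ζ : ⟨ζ, ν⟩ ≤ Γ(ν) ∀ |ν| = 1}` of Theorem 5.2 (`ChambolleKreutz2023.wulffBody`,
  any dimension); `Γ` is typed by the closed form `(2/√3)(|⟨ν,e₁⟩| + |⟨ν,e₂⟩| + |⟨ν,e₂−e₁⟩|)`
  (`hexDensity`), which equals the printed sector formula on `φ ∈ [0, π/3]` (`hexDensity_sector`,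
  PROVED) and is `π/3`-periodic; it is the `φ_hex` of Friedrich–Kreutz–Schmidt 2021
  (`StickyDiskGrainBoundaryEnergy.lean`, over `ℂ`).  `I_∞` is `limitEnergy` (an infimum over the
  representations `μ = ρ χ_E`, `= ⊤` if there is none; `P_K(E)` depends on `E` only up to null sets).
* Γ-convergence of the SEQUENCE `(N^{−1/2}(I_N + 6N))_N`: the liminf inequality is typed along
  subsequences `N_k ↑ ∞` of particle numbers for injective lattice configurations (off which
  `I_N ≡ +∞`, so this is the full content), the recovery clause for every `N`.
* Sequences "for every `N`" (Theorems 1.1, 1.2, recovery sequences) are functions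
  `x : (N : ℕ) → (Fin N → ℝ²)`.

## Contents (namespace `Literature.MathematicalPhysics.StatisticalMechanics.AuYeungFrieseckeSchmidt2012`)

§1 `IsShortRangePotential` ((H1)–(H3)), `IsAdmissible`, `localEnergy`, `energy` ((1.1)),
`IsGroundState`, `HasCrystallizedGroundStates` (Def. 1.1), `IsConnectedConfig` (Def. 3.1); PROVED:
`energy_eq_two_mul_interactionEnergy` (bridge to `Crystallization.interactionEnergy`),
`neg_six_mul_le_energy` ((2.4)), `IsShortRangePotential.lt_sqrt_three_mul` (`β < √3 α`, the content of
the heptagon remark p0007 used here), `exists_energy_le` ((2.5) with `a = 4√3`, `b = 12`, by the tree's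
Harborth spiral), `isShortRangePotential_stickyPotential`, `energy_stickyPotential`,
`isGroundState_stickyPotential_iff`.
§2 `empiricalIntegral` ((1.4) paired with a test function), `WeakStarTo`, `clusterMeasure` (`ρ χ_E`).
§3 NAMED FACT `AuYeungFrieseckeSchmidt2012_clusters` (Theorem 1.1).
§4 `hexDensity` (`Γ`), `scaledSurfaceEnergy` (`N^{−1/2}(I_N(μ_N) + 6N)`), `limitEnergy Γ` (`I_∞`), the
clause predicates `GammaLiminf Γ`, `GammaLimsup Γ`, NAMED FACT `AuYeungFrieseckeSchmidt2012_gammaLimit`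
(Theorem 5.1, `= GammaLiminf hexDensity ∧ GammaLimsup hexDensity`);
PROVED `hexDensity_sector`, `scaledSurfaceEnergy_nonneg`.
§5 `wulffHexagon` (`h`), NAMED FACT `AuYeungFrieseckeSchmidt2012_wulffShape` (Theorem 1.2).
§6 PROVED: the Heitmann–Radin potential HAS crystallized ground states for every `N` ("as is rigorously
known e.g. when `V` is given by (1.3)") — `exists_isMaximalDiscConfig` (ground states exist: Harborth's
spiral attains the tree-proved upper bound), `hasCrystallizedGroundStates_stickyPotential` (Definition 1.1
for (1.3), from `HeitmannRadin1980_groundStates_holds` plus the classification of planar linear isometries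
as rotations / reflected rotations, Mathlib's `linear_isometry_complex`, the reflection being absorbed by the
symmetry `(m, n) ↦ (m + n, −n)` of `A₂`), and the corollary `wulffShape_stickyPotential`: under the fact
`AuYeungFrieseckeSchmidt2012_wulffShape`, EVERY sequence of sticky-disc ground states (maximal contact
configurations) converges, after rotations and translations, to `(2/√3) χ_h`.

WHAT IS NOT HERE: Proposition 3.1 / Lemma 3.2 separately (the diameter bound `diam S ≤ C N^{1/2}`;
contained in Theorem 1.1 (i)); Theorem 5.2 (Taylor 1975 / Fonseca–Müller 1991, the Wulff uniqueness
theorem — an external theorem; the tree has the Wulff INEQUALITY proved, `AnisotropicIsoperimetric.lean`,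
and its quantitative form as the fact `FigalliMaggiPratelli2010_quantitativeWulff`); the `N^{−1/4}`
fluctuation law announced on p0004 (the companion paper, Schmidt 2013 — separate file); the identification
`W_Γ = wulffHexagon · const` and `|wulffHexagon| = √3/2` (not proved here); connectedness of minimizers
("minimizers must always be connected", p0006, unproved remark).
-/

noncomputable section

open MeasureTheory Set Filter Function Metric Finset
open scoped ENNReal Topology Pointwise RealInnerProductSpace

namespace Literature.MathematicalPhysics.StatisticalMechanics.AuYeungFrieseckeSchmidt2012

open Literature.Geometry.DiscreteGeometry (contactPairCount harborthNumber IsMaximalDiscConfig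
  exists_injective_contactPairCount_eq_harborthNumber pairwise_one_le_dist_triPoint)
open Literature.Analysis.Convexity (anisotropicPerimeter)
open Theil2006 (Plane triPoint triVec₁ triVec₂ triangularLattice unitShell)
open ChambolleKreutz2023 (wulffBody)
open CicaleseLeonardi2020 (neighbourHexagon)

variable {N : ℕ}

/-! ## §1 Short-range pair potentials (H1)–(H3), the energy (1.1), ground states -/

/-- **Hypotheses (H1)–(H3) on the pair potential** with hard-core radius `α ∈ (0, 1]` and range
`β ∈ [1, ∞)`: (H1) `V(1) = −1` and `V(r) > −1` for `r ≠ 1` (on the finite-energy range `r ≥ α`);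
(H2) `V(r) = 0` for `r > β`, `V` continuous on `(α, β)` — the hard core "`V(r) = +∞` for `r < α`" being
the admissibility constraint `IsAdmissible α` on configurations; (H3) the closed ball of radius `β`
contains at most six points whose distance from the centre and mutual distances are `≥ α`.
[cite: AuYeungFrieseckeSchmidt2012, §2 (H1)–(H3) (arXiv text p0005)] -/
structure IsShortRangePotential (V : ℝ → ℝ) (α β : ℝ) : Prop where
  alpha_pos : 0 < α
  alpha_le_one : α ≤ 1
  one_le_beta : 1 ≤ β
  eq_neg_one : V 1 = -1
  neg_one_lt : ∀ r : ℝ, α ≤ r → r ≠ 1 → -1 < V r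
  eq_zero : ∀ r : ℝ, β < r → V r = 0
  continuousOn : ContinuousOn V (Set.Ioo α β)
  card_le_six : ∀ T : Finset Plane, (∀ t ∈ T, α ≤ ‖t‖ ∧ ‖t‖ ≤ β) →
    (∀ t ∈ T, ∀ t' ∈ T, t ≠ t' → α ≤ dist t t') → T.card ≤ 6

/-- **Finite-energy (admissible) configurations**: all mutual distances are at least the hard-core
radius `α` (the printed "`V(r) = +∞` for `r < α`"). [cite: AuYeungFrieseckeSchmidt2012, §2 (H2) (p0005)] -/
def IsAdmissible (α : ℝ) (x : Fin N → Plane) : Prop :=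
  Pairwise fun i j => α ≤ dist (x i) (x j)

/-- The **local energy** `E_loc(xᵢ) = Σ_{j ≠ i} V(|xᵢ − xⱼ|)`.
[cite: AuYeungFrieseckeSchmidt2012, §3 proof of Proposition 3.1 (p0006)] -/
def localEnergy (V : ℝ → ℝ) (x : Fin N → Plane) (i : Fin N) : ℝ :=
  ∑ j ∈ univ.erase i, V (dist (x i) (x j))

/-- **The atomistic energy (1.1)** `E(x₁,…,x_N) = Σ_{i ≠ j} V(|xᵢ − xⱼ|)` (ordered pairs; "so that
`E(S) = Σ_{x∈S} E_loc(x)`"). [cite: AuYeungFrieseckeSchmidt2012, (1.1) (p0003) and §3 (p0006)] -/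
def energy (V : ℝ → ℝ) (x : Fin N → Plane) : ℝ :=
  ∑ i, localEnergy V x i

/-- **Minimizers (ground states) of `E` on `(ℝ²)^N`** for a potential with hard core `α`: admissible
configurations of least energy among admissible ones. [cite: AuYeungFrieseckeSchmidt2012, §1 Definition 1.1 (p0003)] -/
def IsGroundState (V : ℝ → ℝ) (α : ℝ) (x : Fin N → Plane) : Prop :=
  IsAdmissible α x ∧ ∀ y : Fin N → Plane, IsAdmissible α y → energy V x ≤ energy V y

/-- **Definition 1.1: `E : (ℝ²)^N → ℝ` has crystallized ground states** — "its infimum is attained and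
any minimizer – after translation and rotation – is a subset of the triangular lattice `𝓛`"
(rotation = linear isometry of determinant `1`). [cite: AuYeungFrieseckeSchmidt2012, Definition 1.1 (p0003)] -/
def HasCrystallizedGroundStates (V : ℝ → ℝ) (α : ℝ) (N : ℕ) : Prop :=
  (∃ x : Fin N → Plane, IsGroundState V α x) ∧
    ∀ x : Fin N → Plane, IsGroundState V α x →
      ∃ (R : Plane ≃ₗᵢ[ℝ] Plane) (a : Plane),
        LinearMap.det (R.toLinearEquiv : Plane →ₗ[ℝ] Plane) = 1 ∧
          ∀ i, R (x i) + a ∈ triangularLattice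

/-- **Definition 3.1: connected configurations** — any two particles are joined by a chain of particles
with successive distances within the interaction range `β`.
[cite: AuYeungFrieseckeSchmidt2012, Definition 3.1 (p0006)] -/
def IsConnectedConfig (β : ℝ) (x : Fin N → Plane) : Prop :=
  ∀ i j : Fin N, Relation.ReflTransGen (fun a b : Fin N => dist (x a) (x b) ≤ β) i j

/-! ### The energy: bridges and the bounds (2.4)–(2.5) (PROVED) -/

/-- `univ ∖ {i} = (i, ∞) ∪ (−∞, i)` in `Fin N`. [folklore] -/
private theorem erase_eq_Ioi_union_Iio (i : Fin N) : univ.erase i = Finset.Ioi i ∪ Finset.Iio i := by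
  ext j
  rw [Finset.mem_erase, Finset.mem_union, Finset.mem_Ioi, Finset.mem_Iio]
  exact ⟨fun h => (lt_or_gt_of_ne h.1).symm,
    fun h => ⟨h.elim (fun h' => (ne_of_lt h').symm) fun h' => ne_of_lt h', Finset.mem_univ j⟩⟩

/-- `(i, ∞)` and `(−∞, i)` are disjoint. [folklore] -/
private theorem disjoint_Ioi_Iio (i : Fin N) : Disjoint (Finset.Ioi i) (Finset.Iio i) :=
  Finset.disjoint_left.2 fun _ h1 h2 => lt_asymm (Finset.mem_Ioi.1 h1) (Finset.mem_Iio.1 h2)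

/-- **`Σ_{i≠j} = 2 Σ_{i<j}`: the energy (1.1) is twice the tree's `interactionEnergy`** (Blanc–Lewin's
`Σ_{i<j} V(|xᵢ − xⱼ|)`, `Crystallization.lean`). [cite: AuYeungFrieseckeSchmidt2012, (1.1) (p0003)] -/
theorem energy_eq_two_mul_interactionEnergy (V : ℝ → ℝ) (x : Fin N → Plane) :
    energy V x = 2 * interactionEnergy V x := by
  unfold energy localEnergy interactionEnergy
  have hsplit : ∀ i : Fin N, ∑ j ∈ univ.erase i, V (dist (x i) (x j)) =
      (∑ j ∈ Finset.Ioi i, V (dist (x i) (x j))) + ∑ j ∈ Finset.Iio i, V (dist (x i) (x j)) := by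
    intro i
    rw [erase_eq_Ioi_union_Iio, sum_union (disjoint_Ioi_Iio i)]
  simp only [hsplit, sum_add_distrib]
  have hcomm : ∑ i : Fin N, ∑ j ∈ Finset.Iio i, V (dist (x i) (x j)) =
      ∑ j : Fin N, ∑ i ∈ Finset.Ioi j, V (dist (x i) (x j)) := by
    refine Finset.sum_comm' ?_
    intro i j
    rw [Finset.mem_Iio, Finset.mem_Ioi]
    exact ⟨fun h => ⟨h.2, Finset.mem_univ j⟩, fun h => ⟨Finset.mem_univ i, h.1⟩⟩
  rw [hcomm]
  simp only [dist_comm]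
  ring

/-- On an admissible configuration the potential is `≥ −1` at every occurring distance ((H1)).
[cite: AuYeungFrieseckeSchmidt2012, §2 (H1) (p0005)] -/
theorem IsShortRangePotential.neg_one_le {V : ℝ → ℝ} {α β : ℝ} (hV : IsShortRangePotential V α β)
    {r : ℝ} (hr : α ≤ r) : -1 ≤ V r := by
  by_cases h : r = 1
  · rw [h, hV.eq_neg_one]
  · exact (hV.neg_one_lt r hr h).le

/-- **Each particle interacts with at most six others, each contributing `≥ −1`: `E_loc(x) ≥ −6`**
("by (H2), (H3), each particle can have a negative interaction energy with at most 6 other particles,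
and by (H1), the interaction energy with each of them is `≥ −1`").
[cite: AuYeungFrieseckeSchmidt2012, §2 (2.4) (p0005) and §3 (3.4) (p0006)] -/
theorem neg_six_le_localEnergy {V : ℝ → ℝ} {α β : ℝ} (hV : IsShortRangePotential V α β)
    {x : Fin N → Plane} (hx : IsAdmissible α x) (i : Fin N) : -6 ≤ localEnergy V x i := by
  classical
  set S : Finset (Fin N) := (univ.erase i).filter fun j => dist (x i) (x j) ≤ β with hS
  -- termwise bound
  have hterm : ∀ j ∈ univ.erase i,
      -(if dist (x i) (x j) ≤ β then (1 : ℝ) else 0) ≤ V (dist (x i) (x j)) := by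
    intro j hj
    have hij : i ≠ j := (ne_of_mem_erase hj).symm
    split_ifs with h
    · exact hV.neg_one_le (hx hij)
    · rw [neg_zero]; exact (hV.eq_zero _ (not_le.1 h)).ge
  have hsum : -(S.card : ℝ) ≤ localEnergy V x i := by
    have h := sum_le_sum hterm
    rw [sum_neg_distrib, sum_boole] at h
    exact h
  -- at most six close neighbours, by (H3) applied to the difference vectors
  have hcard : S.card ≤ 6 := by
    have hinj : Set.InjOn (fun j => x j - x i) ↑S := by
      intro j hj j' hj' h
      have h' : x j - x i = x j' - x i := h
      by_contra hjj
      have h1 : α ≤ dist (x j) (x j') := hx hjj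
      have h2 : dist (x j) (x j') = 0 := by
        rw [dist_eq_norm, show x j - x j' = (x j - x i) - (x j' - x i) by abel, h', sub_self,
          norm_zero]
      linarith [hV.alpha_pos]
    rw [← card_image_of_injOn hinj]
    refine hV.card_le_six _ ?_ ?_
    · intro t ht
      obtain ⟨j, hj, rfl⟩ := mem_image.1 ht
      have hj' := (mem_filter.1 hj)
      have hij : i ≠ j := (ne_of_mem_erase hj'.1).symm
      rw [← dist_eq_norm, dist_comm]
      exact ⟨hx hij, hj'.2⟩
    · intro t ht t' ht' hne
      obtain ⟨j, hj, rfl⟩ := mem_image.1 ht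
      obtain ⟨j', hj', rfl⟩ := mem_image.1 ht'
      have hjj : j ≠ j' := fun h => hne (by rw [h])
      rw [dist_eq_norm, show x j - x i - (x j' - x i) = x j - x j' by abel, ← dist_eq_norm]
      exact hx hjj
  have : (S.card : ℝ) ≤ 6 := by exact_mod_cast hcard
  linarith

/-- **(2.4): `inf E ≥ −6N`** on admissible `N`-particle configurations.
[cite: AuYeungFrieseckeSchmidt2012, §2 (2.4) (p0005)] -/
theorem neg_six_mul_le_energy {V : ℝ → ℝ} {α β : ℝ} (hV : IsShortRangePotential V α β)
    {x : Fin N → Plane} (hx : IsAdmissible α x) : -6 * (N : ℝ) ≤ energy V x := by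
  unfold energy
  calc -6 * (N : ℝ) = ∑ _i : Fin N, (-6 : ℝ) := by simp [mul_comm]
    _ ≤ ∑ i, localEnergy V x i := sum_le_sum fun i _ => neg_six_le_localEnergy hV hx i

/-- **(H3) forces `β < √3 α`** (the source records the sharper `β < α/(2 sin(π/7)) ≈ 1.152 α` by the
same reasoning with a heptagon): otherwise the six nearest neighbours `α·(±e₁, ±e₂, ±(e₂ − e₁))` of the
origin in `α𝓛` together with `α(e₁ + e₂)` (norm `√3 α ≤ β`) are seven points in the closed `β`-ball at
mutual distances `≥ α`. [cite: AuYeungFrieseckeSchmidt2012, §3 proof of Lemma 3.2 (p0007)] -/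
theorem IsShortRangePotential.lt_sqrt_three_mul {V : ℝ → ℝ} {α β : ℝ}
    (hV : IsShortRangePotential V α β) : β < Real.sqrt 3 * α := by
  classical
  by_contra hle
  rw [not_lt] at hle
  have hα := hV.alpha_pos
  have h3 : (1 : ℝ) ≤ Real.sqrt 3 := by
    rw [show (1 : ℝ) = Real.sqrt 1 by simp]
    exact Real.sqrt_le_sqrt (by norm_num)
  -- the seven labels
  let K : Finset (ℤ × ℤ) := insert ((1 : ℤ), (1 : ℤ)) unitShell
  have hK11 : ‖triPoint ((1 : ℤ), (1 : ℤ))‖ = Real.sqrt 3 := by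
    have h2 : ‖triPoint ((1 : ℤ), (1 : ℤ))‖ ^ 2 = 3 := by
      rw [Theil2006.norm_triPoint_sq]; norm_num
    rw [← Real.sqrt_sq (norm_nonneg _), h2]
  have hKcard : K.card = 7 := by decide
  let f : ℤ × ℤ → Plane := fun k => α • triPoint k
  have hf : Function.Injective f := by
    intro k k' h
    exact Theil2006.triPoint_injective (smul_right_injective Plane hα.ne' h)
  have hTcard : (K.image f).card = 7 := by rw [card_image_of_injective _ hf, hKcard]
  have h6 := hV.card_le_six (K.image f) ?_ ?_
  · omega
  · intro t ht
    obtain ⟨k, hk, rfl⟩ := mem_image.1 ht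
    simp only [f, norm_smul, Real.norm_eq_abs, abs_of_pos hα]
    rcases mem_insert.1 hk with rfl | hk
    · rw [hK11]
      exact ⟨le_mul_of_one_le_right hα.le h3, by linarith⟩
    · rw [Theil2006.norm_triPoint_of_mem_unitShell hk, mul_one]
      exact ⟨le_rfl, hV.alpha_le_one.trans hV.one_le_beta⟩
  · intro t ht t' ht' hne
    obtain ⟨k, hk, rfl⟩ := mem_image.1 ht
    obtain ⟨k', hk', rfl⟩ := mem_image.1 ht'
    have hkk : k ≠ k' := fun h => hne (by rw [h])
    simp only [f, dist_eq_norm, ← smul_sub, ← map_sub, norm_smul, Real.norm_eq_abs, abs_of_pos hα]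
    exact le_mul_of_one_le_right hα.le
      (Theil2006.one_le_norm_triPoint (sub_ne_zero.2 hkk))

/-- Potentials agreeing at every occurring distance have the same energy. [folklore] -/
private theorem energy_congr {V W : ℝ → ℝ} {x : Fin N → Plane}
    (h : ∀ i j, i ≠ j → V (dist (x i) (x j)) = W (dist (x i) (x j))) : energy V x = energy W x := by
  unfold energy localEnergy
  refine sum_congr rfl fun i _ => sum_congr rfl fun j hj => h i j (ne_of_mem_erase hj).symm

/-- **The energy of the sticky disc potential on an admissible configuration is `−2 ·` (number of
contact pairs)** (`E = Σ_{i≠j} V_HR = −2 #𝓑`, Schmidt's (2.2)); in particular `I_N(μ_N) + 6N =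
6N − 2 · contactPairCount`. [cite: AuYeungFrieseckeSchmidt2012, (1.1), (1.3) (p0003)] -/
theorem energy_stickyPotential {x : Fin N → Plane} (hx : IsAdmissible 1 x) :
    energy stickyPotential x = -2 * contactPairCount x := by
  classical
  rw [energy_eq_two_mul_interactionEnergy, interactionEnergy_stickyPotential,
    (sum_ite_dist_lt_one_eq_zero_iff x).2 fun i j hij => hx hij, zero_sub]
  have hc : (contactPairCount x : ℝ) =
      ∑ i : Fin N, ∑ j ∈ Finset.Ioi i, if dist (x i) (x j) = 1 then (1 : ℝ) else 0 := by
    unfold contactPairCount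
    rw [natCast_card_filter, Fintype.sum_prod_type]
    refine sum_congr rfl fun i _ => ?_
    rw [← Finset.filter_lt_eq_Ioi, sum_filter]
    refine sum_congr rfl fun j _ => ?_
    simp only [ite_and]
  rw [hc]
  ring

/-- **The Heitmann–Radin sticky disc potential (1.3) satisfies (H1)–(H3) with `α = β = 1`** ("is
contained as a special case (`α = β = 1`)"); (H3) is Harborth's "every disc touches at most six others"
(`Harborth.card_nbrs_le_six`, transported along `ℝ² ≃ ℂ`).
[cite: AuYeungFrieseckeSchmidt2012, §2 after (H3) (p0005)] -/
theorem isShortRangePotential_stickyPotential : IsShortRangePotential stickyPotential 1 1 where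
  alpha_pos := one_pos
  alpha_le_one := le_rfl
  one_le_beta := le_rfl
  eq_neg_one := stickyPotential_one
  neg_one_lt r hr h1 := by
    rw [stickyPotential_of_one_lt (lt_of_le_of_ne hr (Ne.symm h1))]; norm_num
  eq_zero r hr := stickyPotential_of_one_lt hr
  continuousOn := by simp
  card_le_six T hT hd := by
    classical
    have h1 : ∀ t ∈ T, ‖t‖ = 1 := fun t ht => le_antisymm (hT t ht).2 (hT t ht).1
    let e : Plane ≃ₗᵢ[ℝ] ℂ := Complex.orthonormalBasisOneI.repr.symm
    let P : Finset ℂ := insert 0 (T.image e)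
    have himg : ∀ q ∈ T.image e, ‖q - 0‖ = 1 := by
      intro q hq
      obtain ⟨t, ht, rfl⟩ := mem_image.1 hq
      rw [sub_zero, e.norm_map, h1 t ht]
    have hP : Literature.Geometry.DiscreteGeometry.Harborth.IsHard P := by
      intro p hp q hq hpq
      rcases mem_insert.1 hp with rfl | hp
      · rcases mem_insert.1 hq with rfl | hq
        · exact absurd rfl hpq
        · exact (himg q hq).ge
      · rcases mem_insert.1 hq with rfl | hq
        · rw [zero_sub, norm_neg, ← sub_zero p]; exact (himg p hp).ge
        · obtain ⟨t, ht, rfl⟩ := mem_image.1 hp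
          obtain ⟨t', ht', rfl⟩ := mem_image.1 hq
          have htt : t ≠ t' := fun h => hpq (by rw [h])
          rw [← dist_eq_norm, e.dist_map, dist_comm]
          exact hd t ht t' ht' htt
    have hsub : T.image e ⊆ Literature.Geometry.DiscreteGeometry.Harborth.nbrs P 0 := by
      intro q hq
      simp only [Literature.Geometry.DiscreteGeometry.Harborth.nbrs, mem_filter]
      exact ⟨mem_insert_of_mem hq, himg q hq⟩
    calc T.card = (T.image e).card := (card_image_of_injective _ e.injective).symm
      _ ≤ (Literature.Geometry.DiscreteGeometry.Harborth.nbrs P 0).card := card_le_card hsub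
      _ ≤ 6 := Literature.Geometry.DiscreteGeometry.Harborth.card_nbrs_le_six hP 0

/-- **Ground states of the sticky disc energy are exactly Heitmann–Radin's maximal configurations**
(most contact pairs among hard configurations). [cite: AuYeungFrieseckeSchmidt2012, §1 (p0003)] -/
theorem isGroundState_stickyPotential_iff (x : Fin N → Plane) :
    IsGroundState stickyPotential 1 x ↔ IsMaximalDiscConfig x := by
  constructor
  · rintro ⟨hx, hmin⟩
    refine ⟨hx, fun y hy => ?_⟩
    have h := hmin y hy
    rw [energy_stickyPotential hx, energy_stickyPotential hy] at h
    have : (contactPairCount y : ℝ) ≤ contactPairCount x := by linarith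
    exact_mod_cast this
  · rintro ⟨hx, hmax⟩
    refine ⟨hx, fun y hy => ?_⟩
    rw [energy_stickyPotential hx, energy_stickyPotential hy]
    have : (contactPairCount y : ℝ) ≤ contactPairCount x := by exact_mod_cast hmax y hy
    linarith

/-- Under (H1)–(H3) the energy of a configuration drawn injectively from the unit triangular lattice
is its sticky-disc energy `−2 · #contact pairs`: lattice distances are `1` or `≥ √3 > β`.
[cite: AuYeungFrieseckeSchmidt2012, §2 (2.8)–(2.10) (p0005)] -/
theorem energy_triPoint_eq {V : ℝ → ℝ} {α β : ℝ} (hV : IsShortRangePotential V α β)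
    {c : Fin N → ℤ × ℤ} (hc : Function.Injective c) :
    energy V (fun i => triPoint (c i)) = -2 * contactPairCount (fun i => triPoint (c i)) := by
  have hβ : β < Real.sqrt 3 := by
    have := hV.lt_sqrt_three_mul
    nlinarith [hV.alpha_le_one, Real.sqrt_nonneg 3, hV.alpha_pos]
  rw [← energy_stickyPotential (pairwise_one_le_dist_triPoint hc)]
  refine energy_congr fun i j hij => ?_
  rw [Theil2006.dist_triPoint]
  have hne : c i - c j ≠ 0 := sub_ne_zero.2 (hc.ne hij)
  by_cases hsh : c i - c j ∈ unitShell
  · rw [Theil2006.norm_triPoint_of_mem_unitShell hsh, hV.eq_neg_one, stickyPotential_one]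
  · have h3 := Theil2006.sqrt_three_le_norm_triPoint hne hsh
    have hgt : β < ‖triPoint (c i - c j)‖ := lt_of_lt_of_le hβ h3
    rw [hV.eq_zero _ hgt, stickyPotential_of_one_lt (lt_of_le_of_lt hV.one_le_beta hgt)]

/-- **(2.5): `inf E ≤ −6N + a N^{1/2} + b` with `a = 4√3`, `b = 12`**, attained here by the tree's
hexagonal-spiral configurations in `𝓛` (`[3N − √(12N − 3)]` contact pairs, Harborth / Heitmann–Radin),
which are admissible and have `E = −2[3N − √(12N−3)] ≤ −6N + 2√(12N − 3) + 2`.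
[cite: AuYeungFrieseckeSchmidt2012, §2 (2.5)–(2.10) (p0005)] -/
theorem exists_energy_le {V : ℝ → ℝ} {α β : ℝ} (hV : IsShortRangePotential V α β) (N : ℕ) :
    ∃ x : Fin N → Plane, IsAdmissible α x ∧ (∀ i, x i ∈ triangularLattice) ∧
      energy V x ≤ -6 * N + 4 * Real.sqrt 3 * Real.sqrt N + 12 := by
  obtain ⟨c, hc, hcount⟩ := exists_injective_contactPairCount_eq_harborthNumber N
  refine ⟨fun i => triPoint (c i), fun i j hij =>
    hV.alpha_le_one.trans (pairwise_one_le_dist_triPoint hc hij), fun i => ⟨c i, rfl⟩, ?_⟩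
  rw [energy_triPoint_eq hV hc]
  have h1 : ((contactPairCount fun i => triPoint (c i) : ℕ) : ℝ) = (harborthNumber N : ℝ) := by
    exact_mod_cast hcount
  have hfloor : 3 * (N : ℝ) - Real.sqrt (12 * (N : ℝ) - 3) - 1 < ((harborthNumber N : ℤ) : ℝ) := by
    unfold harborthNumber
    exact Int.sub_one_lt_floor _
  have hy : 0 ≤ 2 * Real.sqrt 3 * Real.sqrt N := by positivity
  have h12 : (2 * Real.sqrt 3 * Real.sqrt N) ^ 2 = 12 * (N : ℝ) := by
    rw [mul_pow, mul_pow, Real.sq_sqrt (by norm_num : (0 : ℝ) ≤ 3),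
      Real.sq_sqrt (Nat.cast_nonneg N)]
    ring
  have hsqrt : Real.sqrt (12 * (N : ℝ) - 3) ≤ 2 * Real.sqrt 3 * Real.sqrt N := by
    calc Real.sqrt (12 * (N : ℝ) - 3) ≤ Real.sqrt ((2 * Real.sqrt 3 * Real.sqrt N) ^ 2) :=
          Real.sqrt_le_sqrt (by rw [h12]; linarith)
      _ = 2 * Real.sqrt 3 * Real.sqrt N := Real.sqrt_sq hy
  rw [h1]
  linarith

/-- A ground state (for a potential of the class) has energy `≤ −6N + 4√3 N^{1/2} + 12`, so that
sequences of minimizers satisfy the hypothesis of Theorem 1.1 with `C = 4√3 + 12`.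
[cite: AuYeungFrieseckeSchmidt2012, §2 (2.5) (p0005)] -/
theorem IsGroundState.energy_le {V : ℝ → ℝ} {α β : ℝ} (hV : IsShortRangePotential V α β)
    {x : Fin N → Plane} (hx : IsGroundState V α x) :
    energy V x ≤ -6 * N + 4 * Real.sqrt 3 * Real.sqrt N + 12 := by
  obtain ⟨y, hy, -, hE⟩ := exists_energy_le hV N
  exact (hx.2 y hy).trans hE

/-! ## §2 Re-scaled empirical measures and weak* convergence -/

/-- **`∫ g dμ_N` for the re-scaled empirical measure (1.4)** `μ_N = N⁻¹ Σᵢ δ_{xᵢ/√N}` of an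
`N`-particle configuration. [cite: AuYeungFrieseckeSchmidt2012, (1.4) (p0003)] -/
def empiricalIntegral (x : Fin N → Plane) (g : Plane → ℝ) : ℝ :=
  (N : ℝ)⁻¹ * ∑ i, g ((Real.sqrt N)⁻¹ • x i)

/-- **Weak* convergence `μ_{N_k} ⇀* μ` in `𝓜(ℝ²) = C₀(ℝ²)*`** of the re-scaled empirical measures of a
sequence of configurations `x_k` of `N_k` particles: `∫ g dμ_{N_k} → ∫ g dμ` for every continuous `g`
vanishing at infinity. [cite: AuYeungFrieseckeSchmidt2012, §3 (weak* convergence) (p0006)] -/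
def WeakStarTo (Nk : ℕ → ℕ) (x : (k : ℕ) → (Fin (Nk k) → Plane)) (μ : Measure Plane) : Prop :=
  ∀ g : Plane → ℝ, Continuous g → Tendsto g (cocompact Plane) (𝓝 0) →
    Tendsto (fun k => empiricalIntegral (x k) g) atTop (𝓝 (∫ y, g y ∂μ))

/-- **The cluster measure `ρ χ_E`**, `ρ = 2/√3` the density of atoms per unit volume of the unit
triangular lattice. [cite: AuYeungFrieseckeSchmidt2012, Theorem 1.1 (ii) (p0003)] -/
def clusterMeasure (E : Set Plane) : Measure Plane :=
  ENNReal.ofReal (2 / Real.sqrt 3) • volume.restrict E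

/-! ## §3 Theorem 1.1 (formation of clusters with constant density and finite perimeter) -/

/-- **Au Yeung–Friesecke–Schmidt 2012, Theorem 1.1 (Formation of clusters with constant density and
finite perimeter), NAMED FACT.**  Suppose `V` satisfies (H1)–(H3) (constants `α, β`) and let
`{x₁^{(N)},…,x_N^{(N)}}`, `N ∈ ℕ`, be connected (Definition 3.1) `N`-particle configurations of finite
energy with `E ≤ −6N + C N^{1/2}` for a constant `C` independent of `N`.  Then (i) up to translations
`a_N` and passage to a subsequence the re-scaled empirical measures `μ_N = N⁻¹ Σᵢ δ_{xᵢ/√N}` converge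
weak* in `𝓜(ℝ²)`, and (ii) the limit is `ρ χ_E` with `ρ = 2/√3` and `E` a set of finite perimeter of
volume `1/ρ = √3/2`. [cite: AuYeungFrieseckeSchmidt2012, Theorem 1.1 (i)–(ii) (p0003); Proposition 3.1 (p0006)] -/
def AuYeungFrieseckeSchmidt2012_clusters : Prop :=
  ∀ (V : ℝ → ℝ) (α β : ℝ), IsShortRangePotential V α β →
    ∀ (C : ℝ) (x : (N : ℕ) → (Fin N → Plane)),
      (∀ N, IsAdmissible α (x N)) → (∀ N, IsConnectedConfig β (x N)) →
      (∀ N, energy V (x N) ≤ -6 * N + C * Real.sqrt N) →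
        ∃ (a : ℕ → Plane) (φ : ℕ → ℕ) (E : Set Plane), StrictMono φ ∧ HasFinitePerimeter E ∧
          volume E = ENNReal.ofReal (Real.sqrt 3 / 2) ∧
          WeakStarTo φ (fun k i => x (φ k) i + a k) (clusterMeasure E)

/-! ## §4 Theorem 5.1 (Γ-convergence of the surface energy) -/

/-- **The surface energy density `Γ`** of Theorem 5.1 in closed form:
`Γ(ν) = (2/√3)(|⟨ν, e₁⟩| + |⟨ν, e₂⟩| + |⟨ν, e₂ − e₁⟩|)` — equal to the printed
"`Γ(ν) = 2(ν₂ − ν₁/√3)` for `ν = (−sin φ, cos φ)`, `φ ∈ [0, π/3]`, extended `2π/6`-periodically"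
(`hexDensity_sector`; the closed form is invariant under the rotation by `π/3`, which permutes
`{±e₁, ±e₂, ±(e₂ − e₁)}`). [cite: AuYeungFrieseckeSchmidt2012, Theorem 5.1 (5.3) (p0010)] -/
def hexDensity (ν : Plane) : ℝ :=
  2 / Real.sqrt 3 * (|⟪ν, triVec₁⟫| + |⟪ν, triVec₂⟫| + |⟪ν, triVec₂ - triVec₁⟫|)

/-- **`N^{−1/2}(I_N(μ_N) + 6N)` for the sticky disc energy** of an admissible (in particular a lattice)
configuration: `N^{−1/2}(6N − 2 · #contact pairs)` (`energy_stickyPotential`).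
[cite: AuYeungFrieseckeSchmidt2012, §5 (5.1) and Theorem 5.1 (p0010)] -/
def scaledSurfaceEnergy (x : Fin N → Plane) : ℝ :=
  (Real.sqrt N)⁻¹ * (6 * N - 2 * contactPairCount x)

/-- **The limit functional `I_∞`** with surface energy density `Γ`: `I_∞(μ) = ∫_{∂*E} Γ(ν_E) dH¹` if
`μ = (2/√3)χ_E` for a set `E` of finite perimeter (of volume `√3/2` when `μ` is a probability measure),
`+∞` otherwise; the surface integral rendered as the anisotropic perimeter with constraint body the
Wulff set `W_Γ = {x : x · ν ≤ Γ(ν) ∀ ν ∈ S¹}` of Theorem 5.2 (an infimum over the representations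
`μ = ρ χ_E`; `= ⊤` if there is none).
[cite: AuYeungFrieseckeSchmidt2012, Theorem 5.1 (5.2) (p0010); Theorem 5.2 (p0012)] -/
def limitEnergy (Γ : Plane → ℝ) (μ : Measure Plane) : ℝ≥0∞ :=
  ⨅ (E : Set Plane) (_ : HasFinitePerimeter E ∧ μ = clusterMeasure E),
    anisotropicPerimeter (wulffBody Γ) E

/-- **Theorem 5.1, Γ-liminf inequality** (the "Lower bound" of §5), for a limit density `Γ` (the theorem:
`Γ = hexDensity`): for particle numbers `N_k ↑ ∞` and
configurations `S_k ⊂ 𝓛` of `N_k` distinct lattice points whose re-scaled empirical measures converge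
weak* to a probability measure `μ`, `I_∞(μ) ≤ liminf_k N_k^{−1/2}(I_{N_k}(μ_{N_k}) + 6N_k)`.
[cite: AuYeungFrieseckeSchmidt2012, Theorem 5.1, Lower bound (p0010–p0011)] -/
def GammaLiminf (Γ : Plane → ℝ) : Prop :=
  ∀ (Nk : ℕ → ℕ), StrictMono Nk → ∀ x : (k : ℕ) → (Fin (Nk k) → Plane),
    (∀ k i, x k i ∈ triangularLattice) → (∀ k, Function.Injective (x k)) →
    ∀ μ : Measure Plane, IsProbabilityMeasure μ → WeakStarTo Nk x μ →
      limitEnergy Γ μ ≤ liminf (fun k => ENNReal.ofReal (scaledSurfaceEnergy (x k))) atTop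

/-- **Theorem 5.1, Γ-limsup inequality / recovery sequences** (the "Upper bound" of §5), for a limit
density `Γ` (the theorem: `Γ = hexDensity`): for every set
`E` of finite perimeter and volume `√3/2` there are configurations `S_N ⊂ 𝓛` of `N` distinct points,
`N ∈ ℕ`, whose re-scaled empirical measures converge weak* to `(2/√3)χ_E` and with
`limsup_N N^{−1/2}(I_N(μ_N) + 6N) ≤ ∫_{∂*E} Γ(ν_E) dH¹` ("any set `E` of finite perimeter and volume
`1/ρ` can occur in the limit", p0003). [cite: AuYeungFrieseckeSchmidt2012, Theorem 5.1, Upper bound Steps 1–3 (p0011–p0012)] -/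
def GammaLimsup (Γ : Plane → ℝ) : Prop :=
  ∀ E : Set Plane, HasFinitePerimeter E → volume E = ENNReal.ofReal (Real.sqrt 3 / 2) →
    ∃ x : (N : ℕ) → (Fin N → Plane),
      (∀ N i, x N i ∈ triangularLattice) ∧ (∀ N, Function.Injective (x N)) ∧
      WeakStarTo (fun N => N) x (clusterMeasure E) ∧
      limsup (fun N => ENNReal.ofReal (scaledSurfaceEnergy (x N))) atTop ≤
        anisotropicPerimeter (wulffBody Γ) E

/-- **Au Yeung–Friesecke–Schmidt 2012, Theorem 5.1 (Γ-convergence of `N^{−1/2}(I_N + 6N)` to `I_∞`),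
NAMED FACT** — for the Heitmann–Radin sticky disc energy on the unit triangular lattice, with respect to
weak* convergence of probability measures: liminf inequality and recovery sequences, limit density
`Γ(ν) = 2(ν₂ − ν₁/√3)` on `φ ∈ [0, π/3]` extended `π/3`-periodically.
[cite: AuYeungFrieseckeSchmidt2012, Theorem 5.1 (p0010)] -/
def AuYeungFrieseckeSchmidt2012_gammaLimit : Prop :=
  GammaLiminf hexDensity ∧ GammaLimsup hexDensity

/-- `N^{−1/2}(I_N(μ_N) + 6N) ≥ 0` for hard configurations: at most six contacts per disc
(`neg_six_mul_le_energy` for the sticky potential). [cite: AuYeungFrieseckeSchmidt2012, (2.4) (p0005)] -/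
theorem scaledSurfaceEnergy_nonneg {x : Fin N → Plane} (hx : IsAdmissible 1 x) :
    0 ≤ scaledSurfaceEnergy x := by
  have h := neg_six_mul_le_energy isShortRangePotential_stickyPotential hx
  rw [energy_stickyPotential hx] at h
  exact mul_nonneg (inv_nonneg.2 (Real.sqrt_nonneg _)) (by linarith)

/-- `e₁ = (1, 0)` paired with `ν`: `⟨ν, e₁⟩ = ν₀`. [folklore] -/
private theorem inner_triVec₁ (ν : Plane) : ⟪ν, triVec₁⟫ = ν 0 := by
  simp [triVec₁, EuclideanSpace.inner_eq_star_dotProduct, Fin.sum_univ_two, dotProduct]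

/-- `e₂ = (½, √3/2)` paired with `ν`. [folklore] -/
private theorem inner_triVec₂ (ν : Plane) : ⟪ν, triVec₂⟫ = ν 0 / 2 + Real.sqrt 3 / 2 * ν 1 := by
  simp [triVec₂, EuclideanSpace.inner_eq_star_dotProduct, Fin.sum_univ_two, dotProduct]
  ring

/-- **The closed form of `Γ` is the printed sector formula**: for `φ ∈ [0, π/3]` and
`ν = (−sin φ, cos φ)`, `Γ(ν) = 2(ν₂ − ν₁/√3) = 2(cos φ + sin φ/√3)`.
[cite: AuYeungFrieseckeSchmidt2012, Theorem 5.1 (5.3) (p0010)] -/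
theorem hexDensity_sector {φ : ℝ} (h0 : 0 ≤ φ) (h1 : φ ≤ Real.pi / 3) :
    hexDensity !₂[-Real.sin φ, Real.cos φ] = 2 * (Real.cos φ + Real.sin φ / Real.sqrt 3) := by
  have hπ := Real.pi_pos
  have hs : 0 ≤ Real.sin φ := Real.sin_nonneg_of_nonneg_of_le_pi h0 (by linarith)
  have hs' : Real.sin φ ≤ Real.sqrt 3 / 2 := by
    rw [← Real.sin_pi_div_three]
    exact Real.strictMonoOn_sin.monotoneOn ⟨by linarith, by linarith⟩ ⟨by linarith, by linarith⟩ h1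
  have hc : 1 / 2 ≤ Real.cos φ := by
    rw [← Real.cos_pi_div_three]
    exact Real.strictAntiOn_cos.antitoneOn ⟨h0, by linarith⟩ ⟨by linarith, by linarith⟩ h1
  have h3pos : 0 < Real.sqrt 3 := Real.sqrt_pos.2 (by norm_num)
  have h3c : Real.sqrt 3 * (1 / 2) ≤ Real.sqrt 3 * Real.cos φ :=
    mul_le_mul_of_nonneg_left hc h3pos.le
  set ν : Plane := !₂[-Real.sin φ, Real.cos φ] with hν
  have hν0 : ν 0 = -Real.sin φ := by simp [hν]
  have hν1 : ν 1 = Real.cos φ := by simp [hν]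
  have e1 : ⟪ν, triVec₁⟫ = -Real.sin φ := by rw [inner_triVec₁, hν0]
  have e2 : ⟪ν, triVec₂⟫ = -Real.sin φ / 2 + Real.sqrt 3 / 2 * Real.cos φ := by
    rw [inner_triVec₂, hν0, hν1]
  have e3 : ⟪ν, triVec₂ - triVec₁⟫ = Real.sin φ / 2 + Real.sqrt 3 / 2 * Real.cos φ := by
    rw [inner_sub_right, inner_triVec₂, inner_triVec₁, hν0, hν1]; ring
  have hB : 0 ≤ -Real.sin φ / 2 + Real.sqrt 3 / 2 * Real.cos φ := by linarith
  have hC : 0 ≤ Real.sin φ / 2 + Real.sqrt 3 / 2 * Real.cos φ := by linarith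
  rw [hexDensity, e1, e2, e3, abs_of_nonpos (by linarith), abs_of_nonneg hB, abs_of_nonneg hC]
  field_simp
  ring

/-! ## §5 Theorem 1.2 (emergence of the Wulff shape) -/

/-- **The limiting Wulff hexagon `h`**: the regular hexagon of area `√3/2 = 1/ρ` with bottom edge
parallel to `e₁`, `h = (1/√3) · conv{±e₁, ±e₂, ±(e₂ − e₁)}` (corners `±(1/√3)(1,0)`,
`±(1/(2√3))(1,√3)`, `±(1/(2√3))(−1,√3)`); see the PRINT NOTE of the module docstring.
[cite: AuYeungFrieseckeSchmidt2012, Theorem 1.2 (p0004)] [cite: Schmidt2013, (4)] -/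
def wulffHexagon : Set Plane :=
  (Real.sqrt 3)⁻¹ • neighbourHexagon

/-- **Au Yeung–Friesecke–Schmidt 2012, Theorem 1.2 (crystallization in the Wulff shape), NAMED FACT.**
Suppose `V` satisfies (H1)–(H3) and `E` has crystallized ground states (Definition 1.1) for every `N`
(as is the case for the Heitmann–Radin potential (1.3)).  Then for every sequence of minimizing
`N`-particle configurations, `N ∈ ℕ`, there are rotations `R_N ∈ SO(2)` and translations `a_N` such that
the re-scaled empirical measures of the moved configurations converge weak* to `(2/√3) χ_h`, `h` the
regular hexagon of area `√3/2` with bottom edge parallel to `e₁`.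
[cite: AuYeungFrieseckeSchmidt2012, Theorem 1.2 (p0004); §5 (p0012)] -/
def AuYeungFrieseckeSchmidt2012_wulffShape : Prop :=
  ∀ (V : ℝ → ℝ) (α β : ℝ), IsShortRangePotential V α β →
    (∀ N, HasCrystallizedGroundStates V α N) →
    ∀ x : (N : ℕ) → (Fin N → Plane), (∀ N, IsGroundState V α (x N)) →
      ∃ (R : ℕ → (Plane ≃ₗᵢ[ℝ] Plane)) (a : ℕ → Plane),
        (∀ N, LinearMap.det ((R N).toLinearEquiv : Plane →ₗ[ℝ] Plane) = 1) ∧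
        WeakStarTo (fun N => N) (fun N i => R N (x N i) + a N) (clusterMeasure wulffHexagon)

/-! ## §6 The Heitmann–Radin potential has crystallized ground states (Definition 1.1, PROVED) -/

section StickyGroundStates

open Literature.Geometry.DiscreteGeometry (contactPairCount_le_harborthNumber
  exists_contactPairCount_eq_harborthNumber HeitmannRadin1980_groundStates_holds)

/-- **Ground states of `N` sticky discs exist for every `N`**: Harborth's hexagonal spiral has
`[3N − √(12N − 3)]` contact pairs (tree: `exists_contactPairCount_eq_harborthNumber`), the maximum over
all hard configurations (tree: `contactPairCount_le_harborthNumber`, Harborth 1974 (5)) — "its infimum is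
attained" in Definition 1.1 for the potential (1.3). [cite: AuYeungFrieseckeSchmidt2012, Definition 1.1 and (1.3) (p0003)] -/
theorem exists_isMaximalDiscConfig (N : ℕ) : ∃ x : Fin N → Plane, IsMaximalDiscConfig x := by
  obtain ⟨x, hx, hcount⟩ := exists_contactPairCount_eq_harborthNumber N
  refine ⟨x, hx, fun y hy => ?_⟩
  have h := contactPairCount_le_harborthNumber y hy
  rw [← hcount] at h
  exact_mod_cast h

/-- Complex coordinates on the plane, `(p₀, p₁) ↦ p₀ + p₁ i` (the isometry used in
`HarborthContactNumberProof.lean`). [folklore] -/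
private def cplx : Plane ≃ₗᵢ[ℝ] ℂ := Complex.orthonormalBasisOneI.repr.symm

/-- `cplx (p₀, p₁) = p₀ + p₁ i`. [folklore] -/
private theorem cplx_apply (p : Plane) : cplx p = (p 0 : ℂ) + (p 1 : ℂ) * Complex.I := rfl

/-- Transporting an isometry of `ℂ` to the plane does not change its determinant. [folklore] -/
private theorem det_conj_cplx (g : ℂ ≃ₗᵢ[ℝ] ℂ) :
    LinearMap.det ((cplx.trans (g.trans cplx.symm)).toLinearEquiv : Plane →ₗ[ℝ] Plane) =
      LinearMap.det (g.toLinearEquiv : ℂ →ₗ[ℝ] ℂ) := by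
  have h : ((cplx.trans (g.trans cplx.symm)).toLinearEquiv : Plane →ₗ[ℝ] Plane) =
      (cplx.symm.toLinearEquiv : ℂ →ₗ[ℝ] Plane) ∘ₗ (g.toLinearEquiv : ℂ →ₗ[ℝ] ℂ) ∘ₗ
        (cplx.symm.toLinearEquiv.symm : Plane →ₗ[ℝ] ℂ) := by
    apply LinearMap.ext
    intro p
    rfl
  rw [h, LinearMap.det_conj]

/-- The determinant of a composite of two isometries of the plane is the product. [folklore] -/
private theorem det_trans (R S : Plane ≃ₗᵢ[ℝ] Plane) :
    LinearMap.det ((R.trans S).toLinearEquiv : Plane →ₗ[ℝ] Plane) =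
      LinearMap.det (S.toLinearEquiv : Plane →ₗ[ℝ] Plane) *
        LinearMap.det (R.toLinearEquiv : Plane →ₗ[ℝ] Plane) := by
  have h : ((R.trans S).toLinearEquiv : Plane →ₗ[ℝ] Plane) =
      (S.toLinearEquiv : Plane →ₗ[ℝ] Plane) ∘ₗ (R.toLinearEquiv : Plane →ₗ[ℝ] Plane) := by
    apply LinearMap.ext
    intro p
    rfl
  rw [h, LinearMap.det_comp]

/-- The reflection `(p₀, p₁) ↦ (p₀, −p₁)` of the plane (complex conjugation). [folklore] -/
private def flipY : Plane ≃ₗᵢ[ℝ] Plane := cplx.trans (Complex.conjLIE.trans cplx.symm)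

/-- In complex coordinates `flipY` is conjugation. [folklore] -/
private theorem cplx_flipY (p : Plane) : cplx (flipY p) = (starRingEnd ℂ) (cplx p) := by
  show cplx (cplx.symm (Complex.conjLIE (cplx p))) = _
  rw [LinearIsometryEquiv.apply_symm_apply, Complex.conjLIE_apply]

/-- `det flipY = −1`. [folklore] -/
private theorem det_flipY : LinearMap.det (flipY.toLinearEquiv : Plane →ₗ[ℝ] Plane) = -1 := by
  rw [flipY, det_conj_cplx, Complex.det_conjLIE]

/-- `cplx (m e₁ + n e₂) = (m + n/2) + (√3 n/2) i`. [folklore] -/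
private theorem cplx_triPoint (k : ℤ × ℤ) :
    cplx (triPoint k) = ((k.1 + k.2 / 2 : ℝ) : ℂ) + ((Real.sqrt 3 / 2 * k.2 : ℝ) : ℂ) * Complex.I := by
  rw [cplx_apply, Theil2006.triPoint_apply_zero, Theil2006.triPoint_apply_one]

/-- The reflection `(p₀, p₁) ↦ (p₀, −p₁)` maps the triangular lattice to itself:
`m e₁ + n e₂ ↦ (m + n) e₁ − n e₂`. [folklore] -/
private theorem flipY_triPoint (k : ℤ × ℤ) : flipY (triPoint k) = triPoint (k.1 + k.2, -k.2) := by
  apply cplx.injective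
  rw [cplx_flipY, cplx_triPoint, cplx_triPoint, map_add, map_mul, Complex.conj_ofReal,
    Complex.conj_ofReal, Complex.conj_I]
  push_cast
  ring

/-- `cplx e₁ = 1`. [folklore] -/
private theorem cplx_triVec₁ : cplx triVec₁ = 1 := by
  rw [cplx_apply]; simp [triVec₁]

/-- **The Heitmann–Radin sticky disc potential (1.3) has crystallized ground states (Definition 1.1) for
every particle number `N`** ("as is rigorously known e.g. when `V` is given by (1.3)"): ground states
exist (`exists_isMaximalDiscConfig`) and every ground state is, after a rotation `R ∈ SO(2)` and a
translation, a subset of `𝓛` — for `N ≥ 3` by Heitmann–Radin's theorem (tree: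
`HeitmannRadin1980_groundStates_holds`, which provides a linear isometry; an orientation-reversing one is
corrected by the lattice symmetry `(m,n) ↦ (m+n, −n)`), for `N ≤ 2` directly.
[cite: AuYeungFrieseckeSchmidt2012, Definition 1.1 and Theorem 1.2 ("as is rigorously known …") (p0003–p0004)]
[cite: HeitmannRadin1980, Theorem (2)(a), p. 284] -/
theorem hasCrystallizedGroundStates_stickyPotential :
    ∀ N : ℕ, HasCrystallizedGroundStates stickyPotential 1 N := by
  classical
  have hex : ∀ N : ℕ, ∃ x : Fin N → Plane, IsGroundState stickyPotential 1 x := fun N => by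
    obtain ⟨x, hx⟩ := exists_isMaximalDiscConfig N
    exact ⟨x, (isGroundState_stickyPotential_iff x).2 hx⟩
  have hdet1 : LinearMap.det ((LinearIsometryEquiv.refl ℝ Plane).toLinearEquiv : Plane →ₗ[ℝ] Plane) = 1 :=
    LinearMap.det_id
  have h0 : (0 : Plane) ∈ triangularLattice := ⟨0, map_zero triPoint⟩
  intro N
  refine ⟨hex N, fun x hx => ?_⟩
  have hmax : IsMaximalDiscConfig x := (isGroundState_stickyPotential_iff x).1 hx
  match N, x, hmax with
  | 0, x, _ => exact ⟨LinearIsometryEquiv.refl ℝ Plane, 0, hdet1, fun i => i.elim0⟩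
  | 1, x, _ =>
    refine ⟨LinearIsometryEquiv.refl ℝ Plane, -x 0, hdet1, fun i => ?_⟩
    have hi : i = 0 := Subsingleton.elim i 0
    subst hi
    simpa using h0
  | 2, x, hmax =>
    -- the two discs touch
    have hd : dist (x 0) (x 1) = 1 := by
      let c : Fin 2 → ℤ × ℤ := ![((0 : ℤ), (0 : ℤ)), ((1 : ℤ), (0 : ℤ))]
      have hc : Function.Injective c := by
        intro i j h; fin_cases i <;> fin_cases j <;> simp_all [c]
      have hy := pairwise_one_le_dist_triPoint hc
      have hpos : 0 < contactPairCount fun i => triPoint (c i) := by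
        refine Finset.card_pos.2 ⟨((0 : Fin 2), (1 : Fin 2)), ?_⟩
        simp only [Finset.mem_filter, Finset.mem_univ, true_and]
        refine ⟨by decide, ?_⟩
        rw [Theil2006.dist_triPoint]
        exact Theil2006.norm_triPoint_of_mem_unitShell (by simp [c, unitShell])
      have hle := hmax.2 _ hy
      obtain ⟨p, hp⟩ := Finset.card_pos.1 (lt_of_lt_of_le hpos hle)
      simp only [Finset.mem_filter, Finset.mem_univ, true_and] at hp
      obtain ⟨hp1, hp2⟩ := hp
      have h01 : p.1 = 0 ∧ p.2 = 1 := by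
        obtain ⟨p1, p2⟩ := p
        fin_cases p1 <;> fin_cases p2 <;> simp_all
      rw [h01.1, h01.2] at hp2
      exact hp2
    -- rotate the unit bond vector onto `e₁`
    set u : Plane := x 1 - x 0 with hu
    have hnorm : ‖cplx u‖ = 1 := by rw [cplx.norm_map, hu, ← dist_eq_norm, dist_comm, hd]
    have hz : cplx u ≠ 0 := by
      intro h; rw [h, norm_zero] at hnorm; exact zero_ne_one hnorm
    let a : Circle := ⟨(cplx u)⁻¹, by simp [Submonoid.unitSphere, norm_inv, hnorm]⟩
    let R : Plane ≃ₗᵢ[ℝ] Plane := cplx.trans ((rotation a).trans cplx.symm)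
    have hR : R u = triVec₁ := by
      apply cplx.injective
      show cplx (cplx.symm (rotation a (cplx u))) = cplx triVec₁
      rw [LinearIsometryEquiv.apply_symm_apply, rotation_apply, cplx_triVec₁]
      exact inv_mul_cancel₀ hz
    refine ⟨R, -R (x 0), ?_, fun i => ?_⟩
    · show LinearMap.det ((cplx.trans ((rotation a).trans cplx.symm)).toLinearEquiv : Plane →ₗ[ℝ] Plane) = 1
      rw [det_conj_cplx, det_rotation]
    · fin_cases i
      · simpa using h0
      · show R (x 1) + -R (x 0) ∈ triangularLattice
        rw [← sub_eq_add_neg, ← map_sub, ← hu, hR]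
        exact ⟨((1 : ℤ), (0 : ℤ)), by simp [Theil2006.triPoint, triVec₁]⟩
  | N + 3, x, hmax =>
    obtain ⟨A, t, hA⟩ := HeitmannRadin1980_groundStates_holds (N + 3) (by omega) x hmax
    let A' : Plane ≃ₗᵢ[ℝ] Plane := A.toLinearIsometryEquiv rfl
    have hA' : ∀ p, A' p = A p := fun p => LinearIsometry.toLinearIsometryEquiv_apply A rfl p
    have hback : ∀ i, ∃ k : ℤ × ℤ, A'.symm (x i - t) = triPoint k := by
      intro i
      obtain ⟨k, hk⟩ := hA i
      refine ⟨k, ?_⟩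
      rw [hk, add_sub_cancel_right, ← hA', LinearIsometryEquiv.symm_apply_apply]
    let g : ℂ ≃ₗᵢ[ℝ] ℂ := cplx.symm.trans (A'.symm.trans cplx)
    have hg : A'.symm = cplx.trans (g.trans cplx.symm) := by
      ext p
      simp [g]
    have hdetA : LinearMap.det (A'.symm.toLinearEquiv : Plane →ₗ[ℝ] Plane) =
        LinearMap.det (g.toLinearEquiv : ℂ →ₗ[ℝ] ℂ) := by
      rw [hg, det_conj_cplx]
    obtain ⟨a, hrot | hrefl⟩ := linear_isometry_complex g
    · -- orientation preserving: `A⁻¹` is a rotation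
      refine ⟨A'.symm, -A'.symm t, ?_, fun i => ?_⟩
      · rw [hdetA, hrot, det_rotation]
      · obtain ⟨k, hk⟩ := hback i
        rw [← sub_eq_add_neg, ← map_sub, hk]
        exact ⟨k, rfl⟩
    · -- orientation reversing: compose with the lattice symmetry `flipY`
      refine ⟨A'.symm.trans flipY, -flipY (A'.symm t), ?_, fun i => ?_⟩
      · rw [det_trans, det_flipY, hdetA, hrefl]
        have : LinearMap.det ((Complex.conjLIE.trans (rotation a)).toLinearEquiv : ℂ →ₗ[ℝ] ℂ) =
            LinearMap.det ((rotation a).toLinearEquiv : ℂ →ₗ[ℝ] ℂ) *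
              LinearMap.det (Complex.conjLIE.toLinearEquiv : ℂ →ₗ[ℝ] ℂ) := by
          have h : ((Complex.conjLIE.trans (rotation a)).toLinearEquiv : ℂ →ₗ[ℝ] ℂ) =
              ((rotation a).toLinearEquiv : ℂ →ₗ[ℝ] ℂ) ∘ₗ (Complex.conjLIE.toLinearEquiv : ℂ →ₗ[ℝ] ℂ) := by
            apply LinearMap.ext; intro z; rfl
          rw [h, LinearMap.det_comp]
        rw [this, det_rotation, Complex.det_conjLIE]
        norm_num
      · obtain ⟨k, hk⟩ := hback i
        show flipY (A'.symm (x i)) + -flipY (A'.symm t) ∈ triangularLattice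
        rw [← sub_eq_add_neg, ← map_sub, ← map_sub, hk, flipY_triPoint]
        exact ⟨_, rfl⟩

/-- **Corollary (PROVED modulo the fact): Theorem 1.2 applies to the sticky disc model unconditionally.**
Under `AuYeungFrieseckeSchmidt2012_wulffShape`, for EVERY sequence of ground states of `N` sticky discs
(maximal contact configurations, `N ∈ ℕ`) there are rotations `R_N ∈ SO(2)` and translations `a_N` such
that the re-scaled empirical measures of the moved configurations converge weak* to `(2/√3) χ_h` — the
hypotheses (H1)–(H3) and "crystallized ground states" being theorems for (1.3)
(`isShortRangePotential_stickyPotential`, `hasCrystallizedGroundStates_stickyPotential`).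
[cite: AuYeungFrieseckeSchmidt2012, Theorem 1.2 (p0004)] -/
theorem wulffShape_stickyPotential (h : AuYeungFrieseckeSchmidt2012_wulffShape)
    (x : (N : ℕ) → (Fin N → Plane)) (hx : ∀ N, IsMaximalDiscConfig (x N)) :
    ∃ (R : ℕ → (Plane ≃ₗᵢ[ℝ] Plane)) (a : ℕ → Plane),
      (∀ N, LinearMap.det ((R N).toLinearEquiv : Plane →ₗ[ℝ] Plane) = 1) ∧
      WeakStarTo (fun N => N) (fun N i => R N (x N i) + a N) (clusterMeasure wulffHexagon) :=
  h stickyPotential 1 1 isShortRangePotential_stickyPotential hasCrystallizedGroundStates_stickyPotential x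
    fun N => (isGroundState_stickyPotential_iff (x N)).2 (hx N)

end StickyGroundStates

end Literature.MathematicalPhysics.StatisticalMechanics.AuYeungFrieseckeSchmidt2012

end
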